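import Summits.Schanuel.Schanuel.Theorems.DiophantineDichotomyKhovanskiiApproxTypeEvRareFieldDefs
import HarnessLib

/-!
# Certificate game of line `rare-field-species` (crux `KhovanskiiApproxTypeEv`, stmt-Schanuel-14972)

Route `DiophantineDichotomy` (sub-problem `Schanuel/Schanuel`), crux
`Summit.Schanuel.Schanuel.Theses.DiophantineDichotomy.KhovanskiiApproxTypeEv`, line
`rare-field-species` (SUPPORT skeleton `Cruxes/KhovanskiiApproxTypeEv/Lines/rare_field_species.lean`,
§4–§5; vocabulary module `Theorems/DiophantineDichotomyKhovanskiiApproxTypeEvRareFieldDefs.lean`,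
which declares `gameProfile`, `IsAbelianAlgebraic` and the OPEN named input `ExpNotAbelianLiouville`).
This file is the `Negative/CertificateGame` content the triagers r2-1 / r2-2 asked for, landed flat
next to the other line files (`--supports stmt-Schanuel-14972`; nothing is credited to the summit).

## MODEL (the lemmas below are its arithmetic)

At a free Khovanskii point of rank `n` price a challenger's `y`-part `γ = (γ₁,…,γₙ)` by its degree
profile `f(J) := log_d [ℚ(γ_J):ℚ]` (monotone, subadditive, `f([n]) = 1`), `x_j := f({j})`, naive
height `H` on every coordinate so that `h_abs(γ_j) ≈ log H / d^{x_j}`.  Every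
`(degree, absolute height)`-priced input — singleton floors of exponent `1` (Mahler / Ably `m = 1`
through the penalty transfer) and, for each `m`-sub-tuple `J`, a measure that is a function of
`([ℚ(γ_J):ℚ], h_abs(γ_J))` only, granted at the DIRICHLET-OPTIMAL shape
`exp(−c [ℚ(γ_J):ℚ]^{1+1/m} h_max)` — certifies the `d`-exponent `(1+1/m) f(J) − min_{j∈J} x_j`.
The prover needs SOME certificate `≤ a < 1/(n−1)` against EVERY profile; the adversary profile
`gameProfile n m = (n+1)m/(n(m+1))` equalises all certificates at `(n+1)/(2n)`
(`certificate_value`), and two certificates alone show the adversary cannot force more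
(`two_certificate_cap`): the game's value is exactly `(n+1)/(2n)`, `> 1/(n−1)` iff `n ≥ 3`
(`threshold_lt_cap`).  Realisations: Boolean composita; the all-abelian spread species for every `n`
(`Gal = (ℤ/p)^{2n}`, coordinate degree `p^{n+1} = d^{(n+1)/(2n)}`, every `m`-sub-tuple certificate
`1 + 1/m − (n+1)/(2n) ≥ (n+1)/(2n)`, `spread_subtuple_certificate`); abelian squares (`(ℤ/p)²`,
value `1/2 ≥ 1/(n−1)` at `n ≥ 3`, `threshold_le_half`).  Each species has population `H^{O(1)}` per
level: a barrier of METHOD, not a falsity.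

## Contents

* §1 the certificate game: `gameProfile_self`, `gameProfile_one`, `certificate_value`,
  `gameProfile_mono`, `gameProfile_subadd`, `two_certificate_cap`, `threshold_lt_cap`,
  `threshold_le_half`, `spread_subtuple_certificate`;
* §2 the registered goal `abelianChallengers_repelled_of`: under the OPEN named input
  `ExpNotAbelianLiouville` (used ONLY as an explicit hypothesis, never asserted) the challengers with
  all-abelian `y`-coordinates are repelled at degree exponent `0` in front of `log H` — weightless
  bookkeeping (sup norm ≥ the `y`-defect at slot `0`); and the sanity link `zero_lt_threshold`.
-/

noncomputable section

-- `Summit.Schanuel.Schanuel.…` is the mandated summit/sub-problem namespace (single-conjunct summit), hence: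
set_option linter.dupNamespace false

namespace Summit.Schanuel.Schanuel.Cruxes.KhovanskiiApproxTypeEv.RareFieldSpecies

/-! ## §1 The certificate game (pure arithmetic of the method-class cap `(n+1)/(2n)`) -/

/-- Normalisation: all `n` coordinates together generate the whole field (degree `d¹`). -/
theorem gameProfile_self {n : ℝ} (hn : 0 < n) : gameProfile n n = 1 := by
  unfold gameProfile
  rw [div_eq_one_iff_eq (by positivity)]
  ring

/-- Each single coordinate has degree `d^{(n+1)/(2n)}`. -/
theorem gameProfile_one {n : ℝ} (hn : 0 < n) : gameProfile n 1 = (n + 1) / (2 * n) := by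
  unfold gameProfile
  have h1 : n ≠ 0 := ne_of_gt hn
  field_simp
  ring

/-- EQUALISATION: the Dirichlet-optimal absolute-currency certificate of every `m`-sub-tuple has
`d`-exponent exactly `(n+1)/(2n)` — the same as the singleton floor `gameProfile n 1`. -/
theorem certificate_value {n m : ℝ} (hn : 0 < n) (hm : 0 < m) :
    (1 + 1 / m) * gameProfile n m - gameProfile n 1 = (n + 1) / (2 * n) := by
  unfold gameProfile
  have h1 : n ≠ 0 := ne_of_gt hn
  have h2 : m ≠ 0 := ne_of_gt hm
  have h3 : m + 1 ≠ 0 := by positivity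
  field_simp
  ring

/-- Monotonicity of the profile in `m` (bigger sub-tuples generate bigger fields). -/
theorem gameProfile_mono {n m₁ m₂ : ℝ} (hn : 0 < n) (hm : 0 < m₁) (h : m₁ ≤ m₂) :
    gameProfile n m₁ ≤ gameProfile n m₂ := by
  unfold gameProfile
  have h2 : 0 < m₂ := lt_of_lt_of_le hm h
  rw [div_le_div_iff₀ (by positivity) (by positivity)]
  have key : (n + 1) * m₂ * (n * (m₁ + 1)) - (n + 1) * m₁ * (n * (m₂ + 1)) =
      (n + 1) * n * (m₂ - m₁) := by ring
  have hnn : 0 ≤ (n + 1) * n * (m₂ - m₁) :=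
    mul_nonneg (mul_nonneg (by linarith) hn.le) (sub_nonneg.mpr h)
  linarith

/-- Subadditivity of the profile (composita: `[K_A K_B : ℚ] ≤ [K_A : ℚ][K_B : ℚ]`), on `m ≥ 1`. -/
theorem gameProfile_subadd {n m₁ m₂ : ℝ} (hn : 0 < n) (h1 : 1 ≤ m₁) (h2 : 1 ≤ m₂) :
    gameProfile n (m₁ + m₂) ≤ gameProfile n m₁ + gameProfile n m₂ := by
  unfold gameProfile
  rw [div_add_div _ _ (by positivity) (by positivity),
    div_le_div_iff₀ (by positivity) (by positivity)]
  have hm1 : 0 < m₁ := by linarith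
  have hm2 : 0 < m₂ := by linarith
  nlinarith [mul_pos hn hm1, mul_pos hn hm2, mul_pos hm1 hm2, mul_pos (mul_pos hn hm1) hm2,
    mul_pos (mul_pos hn hn) (mul_pos hm1 hm2), sq_nonneg (m₁ - m₂), mul_pos hn hn]

/-- THE VALUE IS EXACT: singleton floor `t ≤ u := min_j x_j` and full-tuple certificate
`t ≤ (1 + 1/n)·f([n]) − u = (1 + 1/n) − u` already force `t ≤ (n+1)/(2n)` — no `(degree,
absolute height)`-priced architecture is capped HIGHER than the game value either (triage r2-1 (i)). -/
theorem two_certificate_cap {n u t : ℝ} (hn : 0 < n) (h1 : t ≤ u) (h2 : t ≤ (1 + 1 / n) - u) :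
    t ≤ (n + 1) / (2 * n) := by
  have h0 : (1 : ℝ) + 1 / n = (n + 1) / n := by field_simp
  have h3 : 2 * t ≤ (n + 1) / n := by linarith
  have h3' : 2 * t * n ≤ n + 1 := by rwa [le_div_iff₀ hn] at h3
  rw [le_div_iff₀ (by positivity : (0 : ℝ) < 2 * n)]
  calc t * (2 * n) = 2 * t * n := by ring
    _ ≤ n + 1 := h3'

/-- THE CAP BEATS THE THRESHOLD at every rank `n ≥ 3`: `1/(n−1) < (n+1)/(2n)`.  (At `n = 2` it
reverses: `3/4 < 1` — why the LW layer closed at rank `2`, `evLW_two`, with exactly `a = 3/4`.) -/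
theorem threshold_lt_cap {n : ℝ} (hn : 3 ≤ n) : 1 / (n - 1) < (n + 1) / (2 * n) := by
  rw [div_lt_div_iff₀ (by linarith) (by linarith)]
  nlinarith

/-- The abelian-square species (`(ℤ/p)²`, coordinates in `n ≤ p + 1` degree-`p` subfields, `d = p²`)
is certified only at `1/2`, and `1/(n−1) ≤ 1/2` for `n ≥ 3` (equality at `n = 3`). -/
theorem threshold_le_half {n : ℝ} (hn : 3 ≤ n) : 1 / (n - 1) ≤ (1 : ℝ) / 2 := by
  rw [div_le_div_iff₀ (by linarith) (by norm_num)]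
  linarith

/-- The all-abelian SPREAD SPECIES realises the cap for every `n` (triage r2-1): coordinate degree
exponent `(n+1)/(2n)` = singleton certificate, and every `m`-sub-tuple (`1 ≤ m ≤ n`, generating the
whole field) certifies `(1 + 1/m)·1 − (n+1)/(2n) ≥ (n+1)/(2n)`. -/
theorem spread_subtuple_certificate {n m : ℝ} (hn : 0 < n) (hm : 0 < m) (hmn : m ≤ n) :
    (n + 1) / (2 * n) ≤ (1 + 1 / m) - (n + 1) / (2 * n) := by
  have h1 : 1 / n ≤ 1 / m := one_div_le_one_div_of_le hm hmn
  have h2 : (n + 1) / (2 * n) + (n + 1) / (2 * n) = 1 + 1 / n := by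
    field_simp
    ring
  linarith

/-! ## §2 Under the named missing input the abelian challengers are repelled at degree exponent `0` -/

/-- **The card's first lemma, PROVED** (it is weightless bookkeeping; 100 % of the content is the OPEN
input `ExpNotAbelianLiouville`, taken here as an explicit hypothesis and never asserted): under it, at a
point `s ∈ (ℚ̄∖{0})ⁿ` (`n ≥ 1`) every challenger whose `y`-coordinates are ALL abelian algebraic
numbers is repelled at degree exponent `0` in front of `log H` — so the abelian-square / spread
species, on which every `(degree, h_abs)`-priced certificate stops at `≥ 1/2`, would be harmless.
Proof: the sup norm dominates the `y`-defect at slot `0`; apply the hypothesis at `α = s 0`. -/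
theorem abelianChallengers_repelled_of : ExpNotAbelianLiouville → ∀ (n : ℕ) (s : Fin n → ℂ),
    1 ≤ n → (∀ i, IsAlgebraic ℚ (s i)) → (∀ i, s i ≠ 0) →
      ∃ κ C : ℝ, 0 < κ ∧ ∀ d : ℕ, ∃ H₀ : ℕ, ∀ (H : ℕ) (γ : Fin n ⊕ Fin n → ℂ), H₀ ≤ H →
        (∀ j, IsAbelianAlgebraic (γ (Sum.inr j))) →
        (∀ i, ∃ P : Polynomial ℤ, P ≠ 0 ∧ P.natDegree ≤ d ∧ (∀ k, |P.coeff k| ≤ (H : ℤ)) ∧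
          Polynomial.aeval (γ i) P = 0) →
        Real.exp (-(κ * ((d : ℝ) ^ (0 : ℝ) * Real.log H) + C * (d : ℝ) ^ (1 : ℝ))) ≤
          ‖γ - Sum.elim s (Complex.exp ∘ s)‖ := by
  intro h n s hn halg hs0
  set j₀ : Fin n := ⟨0, hn⟩ with hj₀
  obtain ⟨κ, C, hκ, hall⟩ := h (s j₀) (halg j₀) (hs0 j₀)
  refine ⟨κ, C, hκ, fun d => ?_⟩
  obtain ⟨H₀, hH₀⟩ := hall d
  refine ⟨H₀, fun H γ hH hab hpoly => ?_⟩
  have key := hH₀ H (γ (Sum.inr j₀)) hH (hab j₀) (hpoly (Sum.inr j₀))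
  have hcoord : ‖Complex.exp (s j₀) - γ (Sum.inr j₀)‖ ≤ ‖γ - Sum.elim s (Complex.exp ∘ s)‖ := by
    rw [norm_sub_rev]
    simpa using norm_le_pi_norm (γ - Sum.elim s (Complex.exp ∘ s)) (Sum.inr j₀)
  simpa [Real.rpow_zero, Real.rpow_one] using key.trans hcoord

/-- Sanity link to the crux's vocabulary: exponent `a = 0` is allowed by the crux at every rank
`n ≥ 2` (`0 < 1/(n−1)`). -/
theorem zero_lt_threshold {n : ℕ} (hn : 2 ≤ n) : (0 : ℝ) < 1 / ((n : ℝ) - 1) := by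
  have : (2 : ℝ) ≤ n := by exact_mod_cast hn
  exact div_pos one_pos (by linarith)

end Summit.Schanuel.Schanuel.Cruxes.KhovanskiiApproxTypeEv.RareFieldSpecies

end
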